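import Literature.Analysis.OperatorTheory.Enflo2023.Vy
import Literature.Analysis.OperatorTheory.Enflo2023.Extras
import Literature.Analysis.OperatorTheory.Enflo2023.Lemma1Arith
import Literature.Analysis.OperatorTheory.Enflo2023.LimitStep
import HarnessLib

/-!
# Enflo (2023), arXiv:2305.15442v2 — p. 13 after (27): "if Case II happens every time we obtain convergence to a non-cyclic vector" (STEPS row A26), GRANTING (27)

Source under adjudication: P. Enflo, *On the invariant subspace problem in Hilbert spaces*,
arXiv:2305.15442v2 (6 April 2024), bib key `Enflo2023` — a CLAIMED proof of the invariant subspace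
problem on a separable Hilbert space.  This module belongs to the repair-cell record of the claimed
proof (Formaliser 1, Part A: (1)–(27)).  NOTHING here asserts that the paper's argument is correct; no
declaration concludes the invariant subspace problem for an arbitrary operator.  Value (BLOCK-2b):
kernel-checked versions of inferences the text makes — not progress on the problem.

## WHAT THIS FILE TYPES (v2 p. 13, tex L400–L443; the Case II branch of the main step, AFTER (27))

The text: for `δ = εθ/10` let `ℓ'(T)` be norm-minimal for (26) `‖x₀ − ℓ'(T)y₁'‖ ≤ ‖x₀ − (1+δ)y₁'‖`;
"we get (27) `‖ℓ'(T)y₁' − (1+δ)y₁'‖ < (εθ)²`" — the FIRST STEP OF PART A THAT DOES NOT FOLLOW, refuted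
in `CaseII.lean` / `CaseIIMinimal.lean` / `CaseIIT.lean` / `CaseIICyclic.lean`.  The text continues:
"Equation (27) gives `⟨ℓ'(T)y₁', x₀ − ℓ'(T)y₁'⟩ < εθ(1 − 1/20)`, so we can now use Lemma 2 again … Thus,
every time we apply Lemma 2 we either get Case I and we are done, or we get Case II and pass to a smaller
`εθ`, diminished by a factor `(1 − 1/20)`, and not moving more than `(εθ)²` by (27).  So, if Case II
happens every time we obtain convergence to a non-cyclic vector."

Here the logic AFTER (27) is kernel-checked, with (27) GRANTED as a hypothesis at every stage:

* `CaseII.etheta_succ_eq` — the exact identity behind "Equation (27) gives …": writing the new point as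
  `y'' = (1+δ)y + e`, `⟨y'', x₀ − y''⟩ = (1+δ)(εθ − δ‖y‖²) + ⟨e, x₀ − (1+δ)y⟩ − (1+δ)⟨y, e⟩ − ‖e‖²`.
* `CaseII.etheta_succ_le` — hence, if `‖x₀‖ = 1`, `‖x₀ − y‖ ≤ 0.7`, `0 ≤ εθ ≤ 10⁻⁴` and (27) `‖e‖ ≤ (εθ)²`,
  the new `(εθ)' ≤ (1 − 1/20)εθ`: the text's factor FOLLOWS (what matters is `δ‖y‖² ≥ (εθ/10)·0.51`,
  from `‖y‖² = 1 − ‖x₀ − y‖² − 2εθ`; the cross terms are `O((εθ)²)`).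
* `CaseII.radius_le_norm_sub`, `CaseII.step_move_le` — the (26)-radius is at most the old distance (eq. (10)
  with `δ = εθ/10`), and the step moves `y` by at most `(εθ)² + (εθ/10)‖y‖` (the text's "not moving more than
  `(εθ)²`" is the distance to `(1+δ)y₁'`; the displacement of the point itself is dominated by the scaling
  `δy₁'`, of size `εθ/10` — still geometrically summable, which is what the convergence uses).
* THE RUN (section `Run`): `y 0` in the p.4 window `0.3 ≤ ‖x₀ − y 0‖ ≤ 0.7` with `0 ≤ (εθ)₀ ≤ 10⁻⁴`
  (the regime of Lemma 2, "defined for εθ ≤ 10⁻⁴"), and for every `n`: `a n` THE minimal solution of (26) for `V_{y n}`,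
  `y (n+1) = V_{y n}(a n) = ℓ'(T)y_n`, and (27) GRANTED: `‖y (n+1) − (1 + (εθ)_n/10)y n‖ ≤ (εθ)_n²`.  Then:
  `CaseII.run_invariant` (`0 ≤ (εθ)_n ≤ (19/20)^n (εθ)₀` — nonnegativity by the Lagrange identity (5)–(8),
  `IsMinimal.etheta_nonneg`; the distances `‖x₀ − y n‖` do not increase), `CaseII.run_move_le`
  (`‖y(n+1) − y n‖ ≤ 0.11·(19/20)^n·(εθ)₀`), `CaseII.run_tendsto` (the iterates converge IN NORM — `H` complete,
  geometric Cauchy estimate), `CaseII.run_limit_orthogonal` / `run_limit_ne_zero` / `run_limit_sub_ne_zero`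
  (the limit `y_∞ ≠ 0`, `x₀ − y_∞ ≠ 0`, and `⟨T^j y_∞, x₀ − y_∞⟩ = 0` for all `j ≥ 0`, by (9) for every minimal
  move, `Vy.eq9_pow`, and the limit step (11), `orbit_orthogonal_of_norm_limit`), hence
  `CaseII.hasNontrivialClosedInvariantSubspace_of_run`: **granting (27) at every stage, the conclusion of the
  Case II branch ("convergence to a non-cyclic vector", hence a non-trivial closed invariant subspace) is a
  theorem.**
* `CaseII.exists_run` — the iteration itself is always well defined (problem (26) has a minimal solution at
  every stage: `(1+δ)e₀` is feasible, `ℓ²` is complete), so among the hypotheses of the run ONLY (27) carries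
  content; `CaseII.hasNontrivialClosedInvariantSubspace_of_eq27_along_runs` packages this: if (27) holds along
  the Case II iteration started at some `y₀` in the window, `T` has a non-trivial closed invariant subspace.

* WHAT THE CONTRACTION CONSUMES (`CaseII.etheta_smul`, `etheta_eq_of_active`, `etheta_eq_for_minimal`,
  `norm_ge_of_eq27`, `etheta_succ_le_of_norm`): since the constraint of (26) is active at the minimal solution,
  `(εθ)' = (1+δ)(εθ − δ‖y₁'‖²) + ((1+δ)²‖y₁'‖² − ‖ℓ'(T)y₁'‖²)/2` EXACTLY — the new `εθ` sees the move only through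
  the number `‖ℓ'(T)y₁'‖`; the factor `(1 − 1/20)` already follows from the scalar shadow (27″)
  `‖ℓ'(T)y₁'‖ ≥ (1+δ)‖y₁'‖ − εθ/2000` of (27), and norm-minimality (`‖ℓ'‖₂ ≤ 1+δ`) pushes that number DOWN.

FINDING (row A26): the logic after (27) FOLLOWS; on the Case II branch (27) is the ONLY inference that does not.
Remark: the Case II inequality `|⟨T^j y₁', x₀ − y₁'⟩| < (εθ)⁴ (j ≥ 1)` is used by the text only to justify (27);
once (27) is granted it plays no further role — (9), which every minimal move satisfies, already gives the
orthogonality in the limit.  So the typed endgame does not carry it as a hypothesis.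

Dictionary: the paper's `⟨u, v⟩` (linear in `u`) is Mathlib's `⟪v, u⟫_ℂ`; `ℓ2 = lp (fun _ : ℕ => ℂ) 2`;
`V_y = Vy.V T hT y` (needs `‖T‖ < 1`; the paper has `‖T‖ = 10⁻²⁰`); real scalars are coerced into `ℂ`.
STATUS: CLOSED (zero sorry; axioms propext / Classical.choice / Quot.sound).  Origin: planner-b2b-enflo-1-g5-0
(Formaliser 1, gen 5), 2026-08-18.  Imports `…Enflo2023.Vy` (V_y, (9), minimal vectors), `…Extras` (`‖y‖² = 1 − ε² − 2εθ`),
`…Lemma1Arith` (identity behind (10)), `…LimitStep` ((11)).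
-/

open scoped InnerProductSpace ENNReal
open Filter
open _root_.Topology
open Literature.Analysis.UnboundedOperators (inner_self_eq_coe_norm_sq)

noncomputable section

namespace Literature.Analysis.OperatorTheory.Enflo2023

namespace CaseII

open Vy

variable {H : Type*} [NormedAddCommGroup H] [InnerProductSpace ℂ H]

/-! ### One step: the identity behind "Equation (27) gives `(εθ)' < εθ(1 − 1/20)`" -/

/-- Exact identity for the new `εθ` after a step `y ↦ y'' = (1+δ)y + e`:
`⟪x₀ − y'', y''⟫ = (1+δ)(⟪x₀ − y, y⟫ − δ‖y‖²) + ⟪x₀ − (1+δ)y, e⟫ − (1+δ)⟪e, y⟫ − ‖e‖²`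
(here `e = y'' − (1+δ)y`; compare `eq31_exact`, the general change-of-`εθ` identity (31) typed by
formaliser 2 — this is the same bookkeeping organised around the scaling `(1+δ)`). [cite: Enflo2023, v2 p.13, line after eq. (27)] -/
theorem etheta_succ_eq (x₀ y y'' : H) (δ : ℝ) :
    ⟪x₀ - y'', y''⟫_ℂ
      = ((1 + δ : ℝ) : ℂ) * (⟪x₀ - y, y⟫_ℂ - (δ : ℂ) * ((‖y‖ ^ 2 : ℝ) : ℂ))
        + ⟪x₀ - ((1 + δ : ℝ) : ℂ) • y, y'' - ((1 + δ : ℝ) : ℂ) • y⟫_ℂ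
        - ((1 + δ : ℝ) : ℂ) * ⟪y'' - ((1 + δ : ℝ) : ℂ) • y, y⟫_ℂ
        - ((‖y'' - ((1 + δ : ℝ) : ℂ) • y‖ ^ 2 : ℝ) : ℂ) := by
  rw [← inner_self_eq_coe_norm_sq (y'' - ((1 + δ : ℝ) : ℂ) • y), ← inner_self_eq_coe_norm_sq y]
  simp only [inner_sub_left, inner_sub_right, inner_smul_left, inner_smul_right, Complex.conj_ofReal]
  push_cast
  ring

/-- Real part of `etheta_succ_eq`: with `εθ = Re⟪x₀ − y, y⟫`,
`Re⟪x₀ − y'', y''⟫ = (1+δ)(εθ − δ‖y‖²) + Re⟪x₀ − (1+δ)y, e⟫ − (1+δ)Re⟪e, y⟫ − ‖e‖²`. [cite: Enflo2023, v2 p.13, line after eq. (27)] -/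
theorem etheta_succ_re_eq (x₀ y y'' : H) (δ : ℝ) :
    (⟪x₀ - y'', y''⟫_ℂ).re
      = (1 + δ) * ((⟪x₀ - y, y⟫_ℂ).re - δ * ‖y‖ ^ 2)
        + (⟪x₀ - ((1 + δ : ℝ) : ℂ) • y, y'' - ((1 + δ : ℝ) : ℂ) • y⟫_ℂ).re
        - (1 + δ) * (⟪y'' - ((1 + δ : ℝ) : ℂ) • y, y⟫_ℂ).re
        - ‖y'' - ((1 + δ : ℝ) : ℂ) • y‖ ^ 2 := by
  have h := congrArg Complex.re (etheta_succ_eq x₀ y y'' δ)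
  simp only [Complex.add_re, Complex.sub_re, Complex.mul_re, Complex.ofReal_re, Complex.ofReal_im,
    zero_mul, sub_zero] at h
  linarith [h]

/-- `‖x₀ − (1+δ)y‖ ≤ ‖x₀ − y‖ + δ‖y‖` for `δ ≥ 0`. [folklore] -/
lemma norm_sub_smul_le (x₀ y : H) {δ : ℝ} (hδ : 0 ≤ δ) :
    ‖x₀ - ((1 + δ : ℝ) : ℂ) • y‖ ≤ ‖x₀ - y‖ + δ * ‖y‖ := by
  have h1 : x₀ - ((1 + δ : ℝ) : ℂ) • y = (x₀ - y) - (δ : ℂ) • y := by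
    push_cast; rw [add_smul, one_smul]; abel
  rw [h1]
  calc ‖(x₀ - y) - (δ : ℂ) • y‖ ≤ ‖x₀ - y‖ + ‖(δ : ℂ) • y‖ := norm_sub_le _ _
    _ = ‖x₀ - y‖ + δ * ‖y‖ := by rw [norm_smul, Complex.norm_real, Real.norm_of_nonneg hδ]

/-- **"Equation (27) gives `⟨ℓ'(T)y₁', x₀ − ℓ'(T)y₁'⟩ < εθ(1 − 1/20)`" — FOLLOWS.**  If `‖x₀‖ = 1`,
`εθ = Re⟪x₀ − y, y⟫ ∈ [0, 10⁻⁴]`, `‖x₀ − y‖ ≤ 0.7`, and the new point `y''` satisfies (27)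
`‖y'' − (1 + εθ/10)y‖ ≤ (εθ)²`, then `Re⟪x₀ − y'', y''⟫ ≤ (19/20)·εθ` (the text's strict `<` for `εθ > 0`;
in fact `≤ 0.9492·εθ`).  (Mechanism: `‖y‖² = 1 − ‖x₀−y‖² − 2εθ ≥ 0.51 − 2εθ`,
so the scaling alone lowers `εθ` by `δ‖y‖² ≥ 0.051εθ`; the cross terms are `O((εθ)²)`.) [cite: Enflo2023, v2 p.13, line after eq. (27)] -/
theorem etheta_succ_le (x₀ y y'' : H) (t : ℝ) (hx₀ : ‖x₀‖ = 1) (ht : (⟪x₀ - y, y⟫_ℂ).re = t)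
    (ht0 : 0 ≤ t) (ht1 : t ≤ 1 / 10 ^ 4) (hdist : ‖x₀ - y‖ ≤ 0.7)
    (h27 : ‖y'' - ((1 + t / 10 : ℝ) : ℂ) • y‖ ≤ t ^ 2) :
    (⟪x₀ - y'', y''⟫_ℂ).re ≤ (19 / 20) * t := by
  have hδ0 : (0 : ℝ) ≤ t / 10 := by positivity
  -- sizes: ‖y‖² = 1 − ‖x₀ − y‖² − 2εθ ∈ [0.51 − 2εθ, 1]
  have hysq : ‖y‖ ^ 2 = 1 - ‖x₀ - y‖ ^ 2 - 2 * t := by rw [norm_sq_move x₀ y hx₀, ht]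
  have hy1 : ‖y‖ ≤ 1 := norm_move_le_one x₀ y hx₀ (by rw [ht]; exact ht0)
  have hd2 : ‖x₀ - y‖ ^ 2 ≤ 0.49 := by nlinarith [norm_nonneg (x₀ - y)]
  have hs : 0.51 - 2 * t ≤ ‖y‖ ^ 2 := by linarith
  have hE0 : 0 ≤ ‖y'' - ((1 + t / 10 : ℝ) : ℂ) • y‖ := norm_nonneg _
  -- the two cross terms are O((εθ)²)
  have hR1 : (⟪x₀ - ((1 + t / 10 : ℝ) : ℂ) • y, y'' - ((1 + t / 10 : ℝ) : ℂ) • y⟫_ℂ).re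
      ≤ (0.7 + t / 10) * t ^ 2 := by
    have h1 : (⟪x₀ - ((1 + t / 10 : ℝ) : ℂ) • y, y'' - ((1 + t / 10 : ℝ) : ℂ) • y⟫_ℂ).re
        ≤ ‖x₀ - ((1 + t / 10 : ℝ) : ℂ) • y‖ * ‖y'' - ((1 + t / 10 : ℝ) : ℂ) • y‖ :=
      (Complex.re_le_norm _).trans (norm_inner_le_norm _ _)
    have h2 : ‖x₀ - ((1 + t / 10 : ℝ) : ℂ) • y‖ ≤ 0.7 + t / 10 := by
      have h3 := norm_sub_smul_le x₀ y hδ0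
      nlinarith [mul_le_mul_of_nonneg_left hy1 hδ0]
    exact h1.trans (mul_le_mul h2 h27 hE0 (by positivity))
  have hR2 : -(⟪y'' - ((1 + t / 10 : ℝ) : ℂ) • y, y⟫_ℂ).re ≤ t ^ 2 := by
    have h1 : |(⟪y'' - ((1 + t / 10 : ℝ) : ℂ) • y, y⟫_ℂ).re|
        ≤ ‖y'' - ((1 + t / 10 : ℝ) : ℂ) • y‖ * ‖y‖ :=
      (Complex.abs_re_le_norm _).trans (norm_inner_le_norm _ _)
    have h2 : ‖y'' - ((1 + t / 10 : ℝ) : ℂ) • y‖ * ‖y‖ ≤ t ^ 2 :=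
      (mul_le_of_le_one_right hE0 hy1).trans h27
    have h3 := (abs_le.mp (h1.trans h2)).1
    linarith
  -- the identity, then polynomial bookkeeping in `t ≤ 10⁻⁴`
  rw [etheta_succ_re_eq x₀ y y'' (t / 10), ht]
  have f1 : (1 + t / 10) * (t - t / 10 * ‖y‖ ^ 2)
      ≤ (1 + t / 10) * t - (1 + t / 10) * (t / 10) * (0.51 - 2 * t) := by
    nlinarith [mul_nonneg (mul_nonneg (by linarith : (0:ℝ) ≤ 1 + t / 10) hδ0) (sub_nonneg.2 hs)]
  have f3 : -((1 + t / 10) * (⟪y'' - ((1 + t / 10 : ℝ) : ℂ) • y, y⟫_ℂ).re) ≤ (1 + t / 10) * t ^ 2 := by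
    have h4 := mul_le_mul_of_nonneg_left hR2 (by linarith : (0:ℝ) ≤ 1 + t / 10)
    linarith
  have f4 : 0 ≤ ‖y'' - ((1 + t / 10 : ℝ) : ℂ) • y‖ ^ 2 := sq_nonneg _
  have htt : t * t ≤ t * (1 / 10 ^ 4) := mul_le_mul_of_nonneg_left ht1 ht0
  have httt : t * (t * t) ≤ t * (t * (1 / 10 ^ 4)) := mul_le_mul_of_nonneg_left htt ht0
  nlinarith [f1, hR1, f3, f4, htt, httt]

/-! ### One step: the radius of (26) and the size of the move -/

/-- Eq. (10) with `δ = εθ/10`: `‖x₀ − (1 + εθ/10)y‖ ≤ ‖x₀ − y‖` whenever `εθ = Re⟪x₀ − y, y⟫` and `‖y‖² ≤ 20`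
(so the radius of problem (26) is at most the current distance; with `δ = εθ/10` the sign of `εθ` is not even
needed: `‖x₀ − (1+δ)y‖² = ‖x₀ − y‖² − (εθ)²/5 + (εθ)²‖y‖²/100`, `Lemma1.norm_sub_add_smul_sq`). [cite: Enflo2023, v2 p.4, eq. (10); p.13, eq. (26)] -/
theorem radius_le_norm_sub (x₀ y : H) (t : ℝ) (ht : (⟪x₀ - y, y⟫_ℂ).re = t)
    (hy : ‖y‖ ^ 2 ≤ 20) : ‖x₀ - ((1 + t / 10 : ℝ) : ℂ) • y‖ ≤ ‖x₀ - y‖ := by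
  have h := Lemma1.norm_sub_add_smul_sq x₀ y (t / 10)
  rw [ht] at h
  have hsq : ‖x₀ - ((1 + t / 10 : ℝ) : ℂ) • y‖ ^ 2 ≤ ‖x₀ - y‖ ^ 2 := by
    rw [h]; nlinarith [mul_le_mul_of_nonneg_left hy (sq_nonneg t)]
  exact (pow_le_pow_iff_left₀ (norm_nonneg _) (norm_nonneg _) two_ne_zero).mp hsq

/-- The size of one step: if (27) `‖y'' − (1 + εθ/10)y‖ ≤ (εθ)²` then `‖y'' − y‖ ≤ (εθ)² + (εθ/10)‖y‖`
(the displacement is dominated by the scaling `δy`, not by the `(εθ)²` of (27)). [cite: Enflo2023, v2 p.13 ("not moving more than (εθ)² by (27)")] -/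
theorem step_move_le (y y'' : H) (t : ℝ) (ht0 : 0 ≤ t)
    (h27 : ‖y'' - ((1 + t / 10 : ℝ) : ℂ) • y‖ ≤ t ^ 2) :
    ‖y'' - y‖ ≤ t ^ 2 + t / 10 * ‖y‖ := by
  have h1 : y'' - y = (y'' - ((1 + t / 10 : ℝ) : ℂ) • y) + ((t / 10 : ℝ) : ℂ) • y := by
    push_cast; rw [add_smul, one_smul]; abel
  rw [h1]
  calc ‖(y'' - ((1 + t / 10 : ℝ) : ℂ) • y) + ((t / 10 : ℝ) : ℂ) • y‖
        ≤ ‖y'' - ((1 + t / 10 : ℝ) : ℂ) • y‖ + ‖((t / 10 : ℝ) : ℂ) • y‖ := norm_add_le _ _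
    _ ≤ t ^ 2 + t / 10 * ‖y‖ := by
        rw [norm_smul, Complex.norm_real, Real.norm_of_nonneg (by positivity)]
        gcongr

/-! ### The run: Case II at every stage, (27) granted at every stage -/

section Run

variable [CompleteSpace H] (T : H →L[ℂ] H) (hT : ‖T‖ < 1) (x₀ : H) (y : ℕ → H) (a : ℕ → ℓ2) (t : ℕ → ℝ)
  (hx₀ : ‖x₀‖ = 1) (ht : ∀ n, (⟪x₀ - y n, y n⟫_ℂ).re = t n) (ht0 : 0 ≤ t 0) (ht1 : t 0 ≤ 1 / 10 ^ 4)
  (hwin : 0.3 ≤ ‖x₀ - y 0‖ ∧ ‖x₀ - y 0‖ ≤ 0.7)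
  (hmin : ∀ n, IsMinimal (V T hT (y n)) x₀ ‖x₀ - ((1 + t n / 10 : ℝ) : ℂ) • y n‖ (a n))
  (hsucc : ∀ n, y (n + 1) = V T hT (y n) (a n))
  (h27 : ∀ n, ‖y (n + 1) - ((1 + t n / 10 : ℝ) : ℂ) • y n‖ ≤ t n ^ 2)

include hx₀ ht ht0 ht1 hwin hmin hsucc h27

/-- **The run invariant.**  Along the Case II iteration with (27) granted: `0 ≤ (εθ)_n ≤ (19/20)^n (εθ)₀`
("pass to a smaller `εθ`, diminished by a factor `(1 − 1/20)`"; `(εθ)_{n+1} ≥ 0` is (8) for the minimal move,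
`IsMinimal.etheta_nonneg`) and `‖x₀ − y n‖ ≤ 0.7` (the (26)-radii do not exceed the previous distance, eq. (10)). [cite: Enflo2023, v2 p.13, lines after eq. (27)] -/
theorem run_invariant : ∀ n, 0 ≤ t n ∧ t n ≤ (19 / 20) ^ n * t 0 ∧ ‖x₀ - y n‖ ≤ 0.7 := by
  intro n
  induction n with
  | zero => exact ⟨ht0, by simp, hwin.2⟩
  | succ n ih =>
    obtain ⟨hn0, hnle, hnd⟩ := ih
    have hpow1 : (19 / 20 : ℝ) ^ n ≤ 1 := pow_le_one₀ (by norm_num) (by norm_num)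
    have htn1 : t n ≤ 1 / 10 ^ 4 := hnle.trans ((mul_le_of_le_one_left ht0 hpow1).trans ht1)
    have hy1 : ‖y n‖ ≤ 1 := norm_move_le_one x₀ (y n) hx₀ (by rw [ht n]; exact hn0)
    have hy20 : ‖y n‖ ^ 2 ≤ 20 := by nlinarith [norm_nonneg (y n)]
    have hrad : ‖x₀ - ((1 + t n / 10 : ℝ) : ℂ) • y n‖ ≤ ‖x₀ - y n‖ :=
      radius_le_norm_sub x₀ (y n) (t n) (ht n) hy20
    have hrad1 : ‖x₀ - ((1 + t n / 10 : ℝ) : ℂ) • y n‖ < ‖x₀‖ := by rw [hx₀]; linarith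
    have ha0 : a n ≠ 0 := (hmin n).ne_zero hrad1
    obtain ⟨C, hC0, hC⟩ := (hmin n).kkt ha0
    have hpos : 0 ≤ (⟪x₀ - V T hT (y n) (a n), V T hT (y n) (a n)⟫_ℂ).re := IsMinimal.etheta_nonneg hC0 hC
    refine ⟨?_, ?_, ?_⟩
    · rw [← ht (n + 1), hsucc n]; exact hpos
    · have hstep := etheta_succ_le x₀ (y n) (y (n + 1)) (t n) hx₀ (ht n) hn0 htn1 hnd (h27 n)
      rw [ht (n + 1)] at hstep
      calc t (n + 1) ≤ 19 / 20 * t n := hstep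
        _ ≤ 19 / 20 * ((19 / 20) ^ n * t 0) := by gcongr
        _ = (19 / 20) ^ (n + 1) * t 0 := by ring
    · calc ‖x₀ - y (n + 1)‖ = ‖x₀ - V T hT (y n) (a n)‖ := by rw [hsucc n]
        _ ≤ ‖x₀ - ((1 + t n / 10 : ℝ) : ℂ) • y n‖ := (hmin n).norm_sub_le
        _ ≤ ‖x₀ - y n‖ := hrad
        _ ≤ 0.7 := hnd

/-- The distances to `x₀` do not increase along the run: `‖x₀ − y(n+1)‖ ≤ ‖x₀ − (1+δ_n)y n‖ ≤ ‖x₀ − y n‖` ((26) and (10)). [cite: Enflo2023, v2 p.13, eq. (26); p.4, eq. (10)] -/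
theorem run_norm_sub_succ_le (n : ℕ) : ‖x₀ - y (n + 1)‖ ≤ ‖x₀ - y n‖ := by
  obtain ⟨hn0, -, -⟩ := run_invariant T hT x₀ y a t hx₀ ht ht0 ht1 hwin hmin hsucc h27 n
  have hy1 : ‖y n‖ ≤ 1 := norm_move_le_one x₀ (y n) hx₀ (by rw [ht n]; exact hn0)
  have hy20 : ‖y n‖ ^ 2 ≤ 20 := by nlinarith [norm_nonneg (y n)]
  calc ‖x₀ - y (n + 1)‖ = ‖x₀ - V T hT (y n) (a n)‖ := by rw [hsucc n]
    _ ≤ ‖x₀ - ((1 + t n / 10 : ℝ) : ℂ) • y n‖ := (hmin n).norm_sub_le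
    _ ≤ ‖x₀ - y n‖ := radius_le_norm_sub x₀ (y n) (t n) (ht n) hy20

/-- **The moves are geometrically summable**: `‖y(n+1) − y n‖ ≤ 0.11·(19/20)^n·(εθ)₀`
(each step moves by at most `(εθ)_n² + (εθ)_n/10`). [cite: Enflo2023, v2 p.13 ("not moving more than (εθ)²")] -/
theorem run_move_le (n : ℕ) : dist (y n) (y (n + 1)) ≤ 11 / 100 * t 0 * (19 / 20) ^ n := by
  obtain ⟨hn0, hnle, -⟩ := run_invariant T hT x₀ y a t hx₀ ht ht0 ht1 hwin hmin hsucc h27 n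
  have hpow1 : (19 / 20 : ℝ) ^ n ≤ 1 := pow_le_one₀ (by norm_num) (by norm_num)
  have htn1 : t n ≤ 1 / 10 ^ 4 := hnle.trans ((mul_le_of_le_one_left ht0 hpow1).trans ht1)
  have hy1 : ‖y n‖ ≤ 1 := norm_move_le_one x₀ (y n) hx₀ (by rw [ht n]; exact hn0)
  have hmove := step_move_le (y n) (y (n + 1)) (t n) hn0 (h27 n)
  rw [dist_comm, dist_eq_norm]
  have h1 : t n ^ 2 + t n / 10 * ‖y n‖ ≤ 11 / 100 * t n := by
    nlinarith [mul_le_mul_of_nonneg_left hy1 (by positivity : (0:ℝ) ≤ t n / 10),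
      mul_le_mul_of_nonneg_left htn1 hn0]
  calc ‖y (n + 1) - y n‖ ≤ 11 / 100 * t n := hmove.trans h1
    _ ≤ 11 / 100 * ((19 / 20) ^ n * t 0) := by gcongr
    _ = 11 / 100 * t 0 * (19 / 20) ^ n := by ring

/-- **"we obtain convergence"** (in norm): the run is Cauchy with a geometric majorant, `H` is complete. [cite: Enflo2023, v2 p.13, last sentence before the Remark] -/
theorem run_tendsto : ∃ ylim : H, Tendsto y atTop (𝓝 ylim) :=
  cauchySeq_tendsto_of_complete
    (cauchySeq_of_le_geometric (19 / 20) (11 / 100 * t 0) (by norm_num)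
      (run_move_le T hT x₀ y a t hx₀ ht ht0 ht1 hwin hmin hsucc h27))

/-- The limit stays within `2.2·(εθ)₀` of the starting point (sum of the geometric majorant). [folklore] -/
theorem run_dist_limit_le {ylim : H} (hlim : Tendsto y atTop (𝓝 ylim)) :
    dist (y 0) ylim ≤ 11 / 100 * t 0 / (1 - 19 / 20) :=
  dist_le_of_le_geometric_of_tendsto₀ (19 / 20) (11 / 100 * t 0) (by norm_num)
    (run_move_le T hT x₀ y a t hx₀ ht ht0 ht1 hwin hmin hsucc h27) hlim

/-- **"… to a non-cyclic vector"**, orthogonality part: for the norm limit `y_∞` of the run,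
`⟨T^j y_∞, x₀ − y_∞⟩ = 0` for every `j ≥ 0` — by (9) for each minimal move (`Vy.eq9_pow`, bound `(εθ)_{n+1} → 0`)
and the limit step (11) (`orbit_orthogonal_of_norm_limit`). [cite: Enflo2023, v2 p.13 with eq. (9), (11)] -/
theorem run_limit_orthogonal {ylim : H} (hlim : Tendsto y atTop (𝓝 ylim)) :
    ∀ j : ℕ, ⟪x₀ - ylim, (T ^ j) ylim⟫_ℂ = 0 := by
  have hinv := run_invariant T hT x₀ y a t hx₀ ht ht0 ht1 hwin hmin hsucc h27
  -- (εθ)_n → 0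
  have hε' : Tendsto t atTop (𝓝 0) := by
    refine squeeze_zero (fun n => (hinv n).1) (fun n => (hinv n).2.1) ?_
    simpa using (tendsto_pow_atTop_nhds_zero_of_lt_one (by norm_num : (0:ℝ) ≤ 19 / 20)
      (by norm_num : (19 / 20 : ℝ) < 1)).mul_const (t 0)
  have hε : Tendsto (fun n => t (n + 1)) atTop (𝓝 0) := hε'.comp (tendsto_add_atTop_nat 1)
  -- (9) at every stage n+1
  have h9 : ∀ n j, ‖⟪x₀ - y (n + 1), (T ^ j) (y (n + 1))⟫_ℂ‖ ≤ t (n + 1) := by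
    intro n j
    obtain ⟨hn0, -, hnd⟩ := hinv n
    have hy1 : ‖y n‖ ≤ 1 := norm_move_le_one x₀ (y n) hx₀ (by rw [ht n]; exact hn0)
    have hy20 : ‖y n‖ ^ 2 ≤ 20 := by nlinarith [norm_nonneg (y n)]
    have hrad : ‖x₀ - ((1 + t n / 10 : ℝ) : ℂ) • y n‖ ≤ ‖x₀ - y n‖ :=
      radius_le_norm_sub x₀ (y n) (t n) (ht n) hy20
    have ha0 : a n ≠ 0 := (hmin n).ne_zero (by rw [hx₀]; linarith)
    have h := eq9_pow T hT (y n) x₀ _ (a n) (hmin n) ha0 j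
    have ht' := ht (n + 1)
    rw [hsucc n] at ht' ⊢
    rw [ht'] at h
    exact h
  exact orbit_orthogonal_of_norm_limit T x₀ (fun n => y (n + 1)) ylim (fun n => t (n + 1))
    (hlim.comp (tendsto_add_atTop_nat 1)) hε h9

/-- The limit of the run is within `0.7` of `x₀`, hence non-zero (`‖x₀‖ = 1`). [cite: Enflo2023, v2 p.13 with p.4 (‖x₀ − ℓ'(T)y'‖ ≤ 0.7)] -/
theorem run_limit_ne_zero {ylim : H} (hlim : Tendsto y atTop (𝓝 ylim)) : ylim ≠ 0 := by
  have hinv := run_invariant T hT x₀ y a t hx₀ ht ht0 ht1 hwin hmin hsucc h27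
  have hd : Tendsto (fun n => ‖x₀ - y n‖) atTop (𝓝 ‖x₀ - ylim‖) :=
    ((continuous_const.sub continuous_id).norm.tendsto ylim).comp hlim
  have hle : ‖x₀ - ylim‖ ≤ 0.7 := le_of_tendsto' hd fun n => (hinv n).2.2
  exact ne_zero_of_norm_sub_lt_one hx₀ (by linarith)

/-- The limit of the run stays at distance `≥ 0.3 − 2.2·(εθ)₀ > 0` from `x₀`, so `x₀ − y_∞ ≠ 0`. [cite: Enflo2023, v2 p.13 with p.4 (‖x₀ − ℓ'(T)y'‖ ≥ 0.3)] -/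
theorem run_limit_sub_ne_zero {ylim : H} (hlim : Tendsto y atTop (𝓝 ylim)) : x₀ - ylim ≠ 0 := by
  have hd := run_dist_limit_le T hT x₀ y a t hx₀ ht ht0 ht1 hwin hmin hsucc h27 hlim
  rw [dist_eq_norm] at hd
  have h1 : ‖y 0 - ylim‖ ≤ 22 / 10 * t 0 := by
    have : 11 / 100 * t 0 / (1 - 19 / 20) = 22 / 10 * t 0 := by ring
    rw [this] at hd; exact hd
  have h2 : ‖x₀ - y 0‖ ≤ ‖x₀ - ylim‖ + ‖y 0 - ylim‖ := by
    have := norm_sub_le_norm_sub_add_norm_sub x₀ ylim (y 0)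
    rw [norm_sub_rev ylim (y 0)] at this
    exact this
  intro h0
  rw [h0, norm_zero] at h2
  linarith [hwin.1]

/-- **Row A26, GRANTING (27): "if Case II happens every time we obtain convergence to a non-cyclic vector"** —
along the Case II iteration (each `y(n+1) = ℓ'(T)y_n` the minimal solution of (26)) with (27) assumed at every
stage, the iterates converge in norm to `y_∞ ≠ 0` whose orbit is orthogonal to `x₀ − y_∞ ≠ 0`; so `T` has a
non-trivial closed invariant subspace.  ((27) itself is refuted: `CaseII.eq27_false_for_minimal`, `not_eq27Inference`.) [cite: Enflo2023, v2 p.13, last sentence before the Remark] -/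
theorem hasNontrivialClosedInvariantSubspace_of_run : HasNontrivialClosedInvariantSubspace T := by
  obtain ⟨ylim, hlim⟩ := run_tendsto T hT x₀ y a t hx₀ ht ht0 ht1 hwin hmin hsucc h27
  exact hasNontrivialClosedInvariantSubspace_of_orbit_orthogonal' T
    (run_limit_ne_zero T hT x₀ y a t hx₀ ht ht0 ht1 hwin hmin hsucc h27 hlim)
    (run_limit_sub_ne_zero T hT x₀ y a t hx₀ ht ht0 ht1 hwin hmin hsucc h27 hlim)
    (run_limit_orthogonal T hT x₀ y a t hx₀ ht ht0 ht1 hwin hmin hsucc h27 hlim)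

end Run

/-! ### The iteration is always well defined: only (27) carries content -/

/-- The Case II iteration exists from any starting point: at every stage problem (26) (radius
`‖x₀ − (1 + εθ/10)y‖`, `εθ = Re⟪x₀ − y, y⟫`) has a minimal solution, because `(1 + εθ/10)e₀` is feasible and `ℓ²`
is complete (`exists_isMinimal`); set `y(n+1) = V_{y n}(a n)`. [cite: Enflo2023, v2 p.13, eq. (26)] -/
theorem exists_run [CompleteSpace H] (T : H →L[ℂ] H) (hT : ‖T‖ < 1) (x₀ y₀ : H) :
    ∃ (y : ℕ → H) (a : ℕ → ℓ2), y 0 = y₀ ∧ ∀ n,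
      IsMinimal (V T hT (y n)) x₀ ‖x₀ - ((1 + (⟪x₀ - y n, y n⟫_ℂ).re / 10 : ℝ) : ℂ) • y n‖ (a n) ∧
      y (n + 1) = V T hT (y n) (a n) := by
  have hstep : ∀ z : H, ∃ b : ℓ2,
      IsMinimal (V T hT z) x₀ ‖x₀ - ((1 + (⟪x₀ - z, z⟫_ℂ).re / 10 : ℝ) : ℂ) • z‖ b := by
    intro z
    refine exists_isMinimal _ _ _
      ⟨(((1 + (⟪x₀ - z, z⟫_ℂ).re / 10 : ℝ) : ℂ) • lp.single 2 0 (1 : ℂ) : ℓ2), ?_⟩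
    rw [mem_feasible, map_smul, V_single, pow_zero, one_apply_eq_self]
  choose step hstep using hstep
  let y : ℕ → H := fun n => Nat.rec (motive := fun _ => H) y₀ (fun _ z => V T hT z (step z)) n
  refine ⟨y, fun n => step (y n), rfl, fun n => ⟨hstep (y n), ?_⟩⟩
  rfl

/-- **Row A26 packaged: granting (27) along the run, the Case II branch concludes.**  If `‖T‖ < 1`, `‖x₀‖ = 1`,
`y₀` lies in the window `0.3 ≤ ‖x₀ − y₀‖ ≤ 0.7` with `0 ≤ (εθ)₀ = Re⟪x₀ − y₀, y₀⟫ ≤ 10⁻⁴`, and (27) holds at every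
stage of every Case II iteration started at `y₀` (`‖ℓ'(T)y_n − (1 + (εθ)_n/10)y_n‖ ≤ (εθ)_n²`, `ℓ'` minimal for (26)),
then `T` has a non-trivial closed invariant subspace.  The hypothesis `h27` is exactly the refuted inference (27),
quantified along the run; everything else is set-up. [cite: Enflo2023, v2 p.13, eq. (26)–(27) and the last sentence before the Remark] -/
theorem hasNontrivialClosedInvariantSubspace_of_eq27_along_runs [CompleteSpace H] (T : H →L[ℂ] H)
    (hT : ‖T‖ < 1) (x₀ y₀ : H) (hx₀ : ‖x₀‖ = 1) (hwin : 0.3 ≤ ‖x₀ - y₀‖ ∧ ‖x₀ - y₀‖ ≤ 0.7)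
    (ht0 : 0 ≤ (⟪x₀ - y₀, y₀⟫_ℂ).re) (ht1 : (⟪x₀ - y₀, y₀⟫_ℂ).re ≤ 1 / 10 ^ 4)
    (h27 : ∀ (y : ℕ → H) (a : ℕ → ℓ2), y 0 = y₀ →
      (∀ n, IsMinimal (V T hT (y n)) x₀ ‖x₀ - ((1 + (⟪x₀ - y n, y n⟫_ℂ).re / 10 : ℝ) : ℂ) • y n‖ (a n) ∧
        y (n + 1) = V T hT (y n) (a n)) →
      ∀ n, ‖y (n + 1) - ((1 + (⟪x₀ - y n, y n⟫_ℂ).re / 10 : ℝ) : ℂ) • y n‖ ≤ (⟪x₀ - y n, y n⟫_ℂ).re ^ 2) :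
    HasNontrivialClosedInvariantSubspace T := by
  obtain ⟨y, a, hy0, hrun⟩ := exists_run T hT x₀ y₀
  have h27' := h27 y a hy0 hrun
  subst hy0
  exact hasNontrivialClosedInvariantSubspace_of_run T hT x₀ y a (fun n => (⟪x₀ - y n, y n⟫_ℂ).re) hx₀
    (fun n => rfl) ht0 ht1 hwin (fun n => (hrun n).1) (fun n => (hrun n).2) h27'


/-! ### What the contraction actually consumes: the image norm `‖ℓ'(T)y₁'‖` (the weakest form of (27)) -/

/-- The `εθ` of the comparison point `(1+δ)y₁'` of (26):
`Re⟪x₀ − (1+δ)y, (1+δ)y⟫ = (1+δ)(Re⟪x₀ − y, y⟫ − δ‖y‖²)`. [cite: Enflo2023, v2 p.13, eq. (26)] -/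
theorem etheta_smul (x₀ y : H) (δ : ℝ) :
    (⟪x₀ - ((1 + δ : ℝ) : ℂ) • y, ((1 + δ : ℝ) : ℂ) • y⟫_ℂ).re
      = (1 + δ) * ((⟪x₀ - y, y⟫_ℂ).re - δ * ‖y‖ ^ 2) := by
  have h0 : ⟪x₀ - ((1 + δ : ℝ) : ℂ) • y, ((1 + δ : ℝ) : ℂ) • y⟫_ℂ
      = ((1 + δ : ℝ) : ℂ) * (⟪x₀ - y, y⟫_ℂ - (δ : ℂ) * ((‖y‖ ^ 2 : ℝ) : ℂ)) := by
    rw [← inner_self_eq_coe_norm_sq y]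
    simp only [inner_sub_left, inner_smul_left, inner_smul_right, Complex.conj_ofReal]
    push_cast
    ring
  have h := congrArg Complex.re h0
  simp only [Complex.sub_re, Complex.mul_re, Complex.ofReal_re, Complex.ofReal_im, zero_mul,
    sub_zero] at h
  linarith [h]

/-- **The exact formula for the new `εθ` — what "Equation (27) gives …" really consumes.**  If `‖x₀‖ = 1` and the
constraint of (26) is active at the new point, `‖x₀ − y''‖ = ‖x₀ − (1+δ)y‖` (as it is for the minimal solution
`y'' = ℓ'(T)y₁'`: `IsMinimal.norm_sub_eq`), then
`Re⟪x₀ − y'', y''⟫ = (1+δ)(εθ − δ‖y‖²) + ((1+δ)²‖y‖² − ‖y''‖²)/2`.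
So the new `εθ` depends on the move ONLY THROUGH THE NORM `‖ℓ'(T)y₁'‖`, and is the smaller the larger that norm is;
the minimal solution has `‖ℓ'‖₂ ≤ 1+δ`, and norm-minimality pushes `a₀` — hence `‖ℓ'(T)y₁'‖` — DOWN, i.e. against the
contraction (the competitor refuting (27), `CaseII.eq27_false_for_minimal`, is such a move). [cite: Enflo2023, v2 p.13, eq. (26)–(27)] -/
theorem etheta_eq_of_active (x₀ y y'' : H) (δ : ℝ) (hx₀ : ‖x₀‖ = 1)
    (hact : ‖x₀ - y''‖ = ‖x₀ - ((1 + δ : ℝ) : ℂ) • y‖) :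
    (⟪x₀ - y'', y''⟫_ℂ).re
      = (1 + δ) * ((⟪x₀ - y, y⟫_ℂ).re - δ * ‖y‖ ^ 2) + ((1 + δ) ^ 2 * ‖y‖ ^ 2 - ‖y''‖ ^ 2) / 2 := by
  have h1 := norm_sq_move x₀ y'' hx₀
  have h2 := norm_sq_move x₀ (((1 + δ : ℝ) : ℂ) • y) hx₀
  rw [etheta_smul, norm_smul, Complex.norm_real, Real.norm_eq_abs, mul_pow, sq_abs, ← hact] at h2
  linarith

/-- (27) implies its SCALAR SHADOW (27″) `‖y''‖ ≥ (1 + εθ/10)‖y‖ − εθ/2000` whenever `0 ≤ εθ ≤ 1/2000`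
(`‖y''‖ ≥ ‖(1+δ)y‖ − ‖y'' − (1+δ)y‖ ≥ (1+δ)‖y‖ − (εθ)²`). [cite: Enflo2023, v2 p.13, eq. (27)] -/
theorem norm_ge_of_eq27 (y y'' : H) (t : ℝ) (ht0 : 0 ≤ t) (ht1 : t ≤ 1 / 2000)
    (h27 : ‖y'' - ((1 + t / 10 : ℝ) : ℂ) • y‖ ≤ t ^ 2) :
    (1 + t / 10) * ‖y‖ - t / 2000 ≤ ‖y''‖ := by
  have h1 : ‖((1 + t / 10 : ℝ) : ℂ) • y‖ - ‖y''‖ ≤ ‖y'' - ((1 + t / 10 : ℝ) : ℂ) • y‖ := by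
    rw [norm_sub_rev]; exact norm_sub_norm_le _ _
  rw [norm_smul, Complex.norm_real, Real.norm_of_nonneg (by positivity)] at h1
  nlinarith [mul_le_mul_of_nonneg_left ht1 ht0]

/-- **The scalar shadow (27″) of (27) already gives the text's factor `(1 − 1/20)`.**  If `‖x₀‖ = 1`,
`εθ = Re⟪x₀ − y, y⟫ ∈ [0, 10⁻⁴]`, `‖x₀ − y‖ ≤ 0.7`, the constraint of (26) is active at `y''`
(`‖x₀ − y''‖ = ‖x₀ − (1 + εθ/10)y‖`), and (27″) `‖y''‖ ≥ (1 + εθ/10)‖y‖ − εθ/2000`, then `Re⟪x₀ − y'', y''⟫ ≤ (19/20)εθ`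
(by `etheta_eq_of_active`: the norm deficit costs at most `(εθ/2000)·2.71/2 < 0.0007εθ`, the scaling gains `≥ 0.051εθ`).
So the contraction needs the VECTOR `ℓ'(T)y₁'` nowhere near `(1+δ)y₁'`; it needs only that the minimal move does not
LOSE more than `εθ/2000` of image norm against the comparison point.  The norm convergence of the run separately needs
the moves to be summable (`run_move_le` uses (27) for that). [cite: Enflo2023, v2 p.13, line after eq. (27)] -/
theorem etheta_succ_le_of_norm (x₀ y y'' : H) (t : ℝ) (hx₀ : ‖x₀‖ = 1) (ht : (⟪x₀ - y, y⟫_ℂ).re = t)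
    (ht0 : 0 ≤ t) (ht1 : t ≤ 1 / 10 ^ 4) (hdist : ‖x₀ - y‖ ≤ 0.7)
    (hact : ‖x₀ - y''‖ = ‖x₀ - ((1 + t / 10 : ℝ) : ℂ) • y‖)
    (h27'' : (1 + t / 10) * ‖y‖ - t / 2000 ≤ ‖y''‖) :
    (⟪x₀ - y'', y''⟫_ℂ).re ≤ (19 / 20) * t := by
  rw [etheta_eq_of_active x₀ y y'' (t / 10) hx₀ hact, ht]
  have hδ0 : (0 : ℝ) ≤ t / 10 := by positivity
  have hysq : ‖y‖ ^ 2 = 1 - ‖x₀ - y‖ ^ 2 - 2 * t := by rw [norm_sq_move x₀ y hx₀, ht]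
  have hy1 : ‖y‖ ≤ 1 := norm_move_le_one x₀ y hx₀ (by rw [ht]; exact ht0)
  have hy0 : 0 ≤ ‖y‖ := norm_nonneg y
  have hd2 : ‖x₀ - y‖ ^ 2 ≤ 0.49 := by nlinarith [norm_nonneg (x₀ - y)]
  have hs : 0.51 - 2 * t ≤ ‖y‖ ^ 2 := by linarith
  -- ‖y''‖ ≤ ‖x₀‖ + ‖x₀ − y''‖ ≤ 1 + ‖x₀ − y‖ ≤ 1.7
  have hy'' : ‖y''‖ ≤ 1.7 := by
    have h1 : ‖x₀ - (x₀ - y'')‖ ≤ ‖x₀‖ + ‖x₀ - y''‖ := norm_sub_le _ _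
    rw [sub_sub_cancel, hx₀, hact] at h1
    have h2 : ‖x₀ - ((1 + t / 10 : ℝ) : ℂ) • y‖ ≤ ‖x₀ - y‖ :=
      radius_le_norm_sub x₀ y t ht (by nlinarith)
    linarith
  have hy''0 : 0 ≤ ‖y''‖ := norm_nonneg y''
  -- the scaling term: ≤ 0.949·t + O(t²)
  have f1 : (1 + t / 10) * (t - t / 10 * ‖y‖ ^ 2)
      ≤ (1 + t / 10) * t - (1 + t / 10) * (t / 10) * (0.51 - 2 * t) := by
    nlinarith [mul_nonneg (mul_nonneg (by linarith : (0:ℝ) ≤ 1 + t / 10) hδ0) (sub_nonneg.2 hs)]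
  -- the norm-deficit term: ≤ (t/2000)·2.71
  have f2 : (1 + t / 10) ^ 2 * ‖y‖ ^ 2 - ‖y''‖ ^ 2
      = ((1 + t / 10) * ‖y‖ - ‖y''‖) * ((1 + t / 10) * ‖y‖ + ‖y''‖) := by ring
  have f3 : ((1 + t / 10) * ‖y‖ - ‖y''‖) * ((1 + t / 10) * ‖y‖ + ‖y''‖)
      ≤ t / 2000 * ((1 + t / 10) * ‖y‖ + ‖y''‖) :=
    mul_le_mul_of_nonneg_right (by linarith) (by positivity)
  have f4 : t / 2000 * ((1 + t / 10) * ‖y‖ + ‖y''‖) ≤ t / 2000 * 2.71 := by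
    apply mul_le_mul_of_nonneg_left _ (by positivity)
    nlinarith [mul_le_mul_of_nonneg_left hy1 hδ0]
  have htt : t * t ≤ t * (1 / 10 ^ 4) := mul_le_mul_of_nonneg_left ht1 ht0
  have httt : t * (t * t) ≤ t * (t * (1 / 10 ^ 4)) := mul_le_mul_of_nonneg_left htt ht0
  rw [f2]
  nlinarith [f1, f3, f4, htt, httt]

/-- For the MINIMAL solution of (26) the constraint is active, so the exact formula applies to the text's `ℓ'(T)y₁'`:
`(εθ)' = (1+δ)(εθ − δ‖y₁'‖²) + ((1+δ)²‖y₁'‖² − ‖ℓ'(T)y₁'‖²)/2` — with `‖ℓ'‖₂ ≤ 1+δ` (the comparison point is feasible).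
[cite: Enflo2023, v2 p.13, eq. (26)] -/
theorem etheta_eq_for_minimal [CompleteSpace H] (T : H →L[ℂ] H) (hT : ‖T‖ < 1) (x₀ y : H) (δ : ℝ) (a : ℓ2)
    (hx₀ : ‖x₀‖ = 1) (hmin : IsMinimal (V T hT y) x₀ ‖x₀ - ((1 + δ : ℝ) : ℂ) • y‖ a)
    (hlt : ‖x₀ - ((1 + δ : ℝ) : ℂ) • y‖ < 1) :
    (⟪x₀ - V T hT y a, V T hT y a⟫_ℂ).re
        = (1 + δ) * ((⟪x₀ - y, y⟫_ℂ).re - δ * ‖y‖ ^ 2) + ((1 + δ) ^ 2 * ‖y‖ ^ 2 - ‖V T hT y a‖ ^ 2) / 2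
      ∧ ‖a‖ ≤ |1 + δ| := by
  refine ⟨etheta_eq_of_active x₀ y _ δ hx₀ (hmin.norm_sub_eq (by rw [hx₀]; exact hlt)), ?_⟩
  have hfeas : (((1 + δ : ℝ) : ℂ) • lp.single 2 0 (1 : ℂ) : ℓ2) ∈ feasible (V T hT y) x₀ ‖x₀ - ((1 + δ : ℝ) : ℂ) • y‖ := by
    rw [mem_feasible, map_smul, V_single, pow_zero, one_apply_eq_self]
  have h := hmin.norm_le hfeas
  rw [norm_smul, Complex.norm_real, Real.norm_eq_abs, lp.norm_single (by norm_num), norm_one, mul_one] at h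
  exact h

end CaseII

end Literature.Analysis.OperatorTheory.Enflo2023

end
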